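import Literature.Computability.MetaComplexity.ChenJinWilliams2019.SearchMagnification
import Literature.Computability.MetaComplexity.ChenJinWilliams2019.UniformAdviceRAM
import HarnessLib

/-!
# Chen–Jin–Williams 2019, Theorem 1.8: hardness magnification from `search-MCSP` / `search-MKtP`
# against UNIFORM time–space-bounded algorithms with small advice (D16b: word-RAM programs that
# OUTPUT a string)

Citation header. L. Chen, C. Jin, R. R. Williams, *Hardness Magnification for all Sparse NP
Languages*, FOCS 2019 [bib: `ChenJinWilliams2019`]; full version ECCC TR19-118 (held text
`paper:url-5c604605311c`; locators `p. N Lk` are lines of that text): Thm. 1.8 (p. 6 L18–23, lead-in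
L15–17), its reminder and proof sketch (§5, p. 20 L21–30), the output convention of §5 (p. 17 L23–28,
typed in `SearchMagnification.lean` as `SearchMCSPCorrect` / `SearchMKtPCorrect`), and the model
sentence of §2 (p. 9 L4: *"We assume a RAM model when we describe algorithms."*).

Verbatim (p. 6 L15–23): *"Against Uniform Algorithms with Small Advice. Similar to the case of
Theorem 1.2, we also show that it suffices to prove lower bounds against n^{1+ε}-time n^ε-space
deterministic algorithms with n^ε bits of advice, instead of Circuit[n^{1+ε}]. Theorem 1.8. • Let
C ∈ {⊕P, PP, PSPACE}, and m ≤ s(m) ≤ 2^{(1−Ω(1))m}. If search-MCSP[s(m)] on input length n = 2^m is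
not computable by an n · poly(s(m))-time poly(s(m))-space deterministic algorithm with poly(s(m))
bits of advice, then C ⊄ Circuit[poly(n)]. • Let log n ≤ p(n) ≤ n^{1−Ω(1)}. If search-MKtP[p(n)] is
not computable by an n · poly(p(n))-time poly(p(n))-space deterministic algorithm with poly(p(n))
bits of advice, then EXP ⊄ Circuit[poly(n)]."* Proof sketch (p. 20 L28–30): *"We slightly modify
the proof for Theorem 1.6 in the previous two sections: use the hash function M_v from Lemma 3.3
(fully explicit version), so that O_det can compute M_v(x) using small space and small advice (as in
the proof of Theorem 1.2)."*

## Rendering (every choice makes the typed theorem WEAKER than, or equal to, print)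

* **D16b — the device.** The uniform algorithms are the deterministic oracle-free word-RAM programs
  of `UniformAdviceRAM.lean` (D16), started exactly as there on `advInput x α` (the input bits and
  the advice bits as words, word size `advWordSize k x α`); the only new ingredient is that the run
  must halt with an OUTPUT STRING `y` (`OutputsAdvWithin`: the tree's `WordRAM.OutputsWithin` with
  output word list `y.map Bool.toNat`, one bit per word, in the `readOut` convention of
  `Cryptography/WordRAM.lean`) instead of one answer bit; `AnswersAdvWithin P k x α b T` IS
  `OutputsAdvWithin P k x α [b] T` (`answersAdvWithin_iff_outputsAdvWithin`, `rfl`). A RAM / multitape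
  algorithm of print that writes its output string on a tape is simulated by a word-RAM program that
  leaves the string in cells `1 … |y|` with `|y|` in cell `0` at constant-factor cost in time and
  `O(|y|) = poly(s(m))` extra dirty words — inside print's own `poly(s(m))` space budget — so the
  typed solver class CONTAINS print's (the design notes of D16 apply verbatim), the typed hypothesis
  "no such word-RAM program" IMPLIES the printed one, and each typed implication is implied by the
  printed theorem.
* **Budgets.** "`n·poly(s(m))`-time `poly(s(m))`-space … `poly(s(m))` bits of advice" ≔ ONE constant
  `c` with time `c·(n·s(m)^c) + c`, at most `c·s(m)^c + c` dirty words on every reached configuration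
  (`StaysWithinSpace`, D16), advice length `≤ c·s(m)^c + c` (a maximum of the three printed constants
  serves for all; `m ≤ s(m)` makes the additive `c` absorb the finitely many small `m`). Space is
  counted in WORDS (over-counting print's bits, which again only enlarges the class).
* **The search problems** are print's, as typed in `SearchMagnification.lean` (D12): on input
  `x ∈ {0,1}^{2^m}` the output `y ∈ {0,1}^{L+1}`, `L = descLen s(m)`, must satisfy
  `SearchMCSPCorrect (s m) x y` (all-zero on a NO instance, `1⟨C_padded⟩` for SOME witness circuit on
  a YES instance); for `search-MKtP[p]` on `x ∈ {0,1}^n` the output `y ∈ {0,1}^{p(n)+2}` must satisfy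
  `SearchMKtPCorrect U (p n) x y` (reference machine `U`, as every `Kt` statement of the tree).
  "Computable" = one program correct on EVERY input of every length `n = 2^m` (resp. every `n`);
  inputs of other lengths carry no requirement (print: "on input length n = 2^m").
* **Regimes** `m ≤ s(m) ≤ 2^{(1−Ω(1))m}` and `log n ≤ p(n) ≤ n^{1−Ω(1)}` are `SizeRegime` /
  `KtRegime` of `SearchMagnification.lean` (shared with Thm. 1.6).
* **Conclusions.** `C ⊄ Circuit[poly(n)]` for `C = PSPACE` only — `⊕P` and `PP` have no decl in the
  tree and `⊕P ∪ PP ⊆ PSPACE` makes `¬ (PSPACE ⊆ PPoly)` the WEAKEST of the three printed conclusions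
  (the same choice as `thm16_item1`); `EXP ⊄ Circuit[poly(n)]` is `¬ (EXP ⊆ PPoly)` (as
  `thm16_MKtP_item1`).

What is PROVED here: only the bookkeeping identity with D16 (`answersAdvWithin_iff_outputsAdvWithin`)
and monotonicity of the output predicate in the time bound. The two printed implications are the
named facts `thm18_item1` (C = PSPACE) and `thm18_item2 U` (debt +2).
-/

namespace Literature.Computability.MetaComplexity.ChenJinWilliams2019

open Literature.Computability.Cryptography.WordRAM StateTransition
open Literature.Computability.Complexity

/-! ### D16b — word-RAM programs with advice that output a string -/

/-- `OutputsAdvWithin P k x α y T`: started on `advInput x α` (word size `advWordSize k x α`, no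
oracle, zero coins), `P` halts within `T` steps with output word list `y.map Bool.toNat` (the bit
string `y`, one bit per word, in the `readOut` convention). [cite: ChenJinWilliams2019, Thm. 1.8 ("computable by an … algorithm with … bits of advice"); §2 p. 9 L4 (RAM model)] -/
def OutputsAdvWithin (P : Program) (k : ℕ) (x α y : List Bool) (T : ℕ) : Prop :=
  OutputsWithin P (advWordSize k x α) noOracle zeroCoins (advInput x α) (y.map Bool.toNat) T

/-- D16's answer bit is the one-bit output string. [folklore] -/
theorem answersAdvWithin_iff_outputsAdvWithin (P : Program) (k : ℕ) (x α : List Bool) (b : Bool)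
    (T : ℕ) : AnswersAdvWithin P k x α b T ↔ OutputsAdvWithin P k x α [b] T :=
  Iff.rfl

/-- Monotonicity in the time bound. [folklore] -/
theorem OutputsAdvWithin.mono {P : Program} {k : ℕ} {x α y : List Bool} {T T' : ℕ}
    (h : OutputsAdvWithin P k x α y T) (hT : T ≤ T') : OutputsAdvWithin P k x α y T' :=
  OutputsWithin.mono h hT

/-! ### `search-MCSP[s(m)]` against `n·poly(s)` time, `poly(s)` space, `poly(s)` advice -/

/-- **`search-MCSP[s(m)]` is computable by an `n·poly(s(m))`-time `poly(s(m))`-space deterministic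
(word-RAM) algorithm with `poly(s(m))` bits of advice**: one deterministic oracle-free program `P`,
a word-size constant `k`, one constant `c` and advice strings `α m` of length `≤ c·s(m)^c + c` such
that on EVERY input `x ∈ {0,1}^{2^m}` the run outputs, within `c·(2^m·s(m)^c) + c` steps and with at
most `c·s(m)^c + c` dirty memory words on every reached configuration, a string
`y ∈ {0,1}^{L+1}` that is `SearchMCSPCorrect` (§5 output convention). [cite: ChenJinWilliams2019, Thm. 1.8 item 1 (the refuted algorithm class), p. 6 L19–21] -/
def SearchMCSPUniformlySolvable (s : ℕ → ℕ) : Prop :=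
  ∃ (P : Program) (k c : ℕ) (α : ℕ → List Bool), P.IsDeterministic ∧ P.IsOracleFree ∧
    (∀ m, (α m).length ≤ c * s m ^ c + c) ∧
    ∀ (m : ℕ) (x : Fin (2 ^ m) → Bool), ∃ y : Fin (descLen (s m) + 1) → Bool,
      SearchMCSPCorrect (s m) x y ∧
      OutputsAdvWithin P k (List.ofFn x) (α m) (List.ofFn y) (c * (2 ^ m * s m ^ c) + c) ∧
      StaysWithinSpace P (advWordSize k (List.ofFn x) (α m)) (advInput (List.ofFn x) (α m))
        (c * s m ^ c + c)

/-- **Thm. 1.8 item 1, `C = PSPACE`**: for `m ≤ s(m) ≤ 2^{(1−Ω(1))m}`, if `search-MCSP[s(m)]` is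
not computable by an `n·poly(s(m))`-time `poly(s(m))`-space deterministic algorithm with
`poly(s(m))` bits of advice, then `PSPACE ⊄ Circuit[poly(n)]`. OPEN — a named `Prop` (print proves
it; not re-proved here). [cite: ChenJinWilliams2019, Thm. 1.8 item 1 (C = PSPACE), p. 6 L19–21; proof sketch p. 20 L28–30] -/
def thm18_item1 : Prop :=
  ∀ s : ℕ → ℕ, SizeRegime s → ¬ SearchMCSPUniformlySolvable s → ¬ (PSPACE ⊆ PPoly)

/-! ### `search-MKtP[p(n)]` against `n·poly(p)` time, `poly(p)` space, `poly(p)` advice -/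

section MKtP

variable (U : UniversalMachine)

/-- **`search-MKtP[p(n)]` is computable by an `n·poly(p(n))`-time `poly(p(n))`-space deterministic
(word-RAM) algorithm with `poly(p(n))` bits of advice** (reference machine `U`): as
`SearchMCSPUniformlySolvable`, at every input length `n`, with outputs `y ∈ {0,1}^{p(n)+2}` that are
`SearchMKtPCorrect`. [cite: ChenJinWilliams2019, Thm. 1.8 item 2 (the refuted algorithm class), p. 6 L22–23] -/
def SearchMKtPUniformlySolvable (p : ℕ → ℕ) : Prop :=
  ∃ (P : Program) (k c : ℕ) (α : ℕ → List Bool), P.IsDeterministic ∧ P.IsOracleFree ∧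
    (∀ n, (α n).length ≤ c * p n ^ c + c) ∧
    ∀ (n : ℕ) (x : Fin n → Bool), ∃ y : Fin (p n + 2) → Bool,
      SearchMKtPCorrect U (p n) x y ∧
      OutputsAdvWithin P k (List.ofFn x) (α n) (List.ofFn y) (c * (n * p n ^ c) + c) ∧
      StaysWithinSpace P (advWordSize k (List.ofFn x) (α n)) (advInput (List.ofFn x) (α n))
        (c * p n ^ c + c)

/-- **Thm. 1.8 item 2** (`C = EXP`, `search-MKtP`): for `log n ≤ p(n) ≤ n^{1−Ω(1)}`, if
`search-MKtP[p(n)]` is not computable by an `n·poly(p(n))`-time `poly(p(n))`-space deterministic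
algorithm with `poly(p(n))` bits of advice, then `EXP ⊄ Circuit[poly(n)]`. OPEN — a named `Prop`,
for the reference machine `U`. [cite: ChenJinWilliams2019, Thm. 1.8 item 2, p. 6 L22–23; proof sketch p. 20 L28–30] -/
def thm18_item2 : Prop :=
  ∀ p : ℕ → ℕ, KtRegime p → ¬ SearchMKtPUniformlySolvable U p → ¬ (EXP ⊆ PPoly)

end MKtP

end Literature.Computability.MetaComplexity.ChenJinWilliams2019
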